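import Summits.CriticalPhenomena.PercolationContinuityZ3.Theorems.PercNearOneGluingNoHeavyLowerTailPocketMoments
import Summits.CriticalPhenomena.PercolationContinuityZ3.Theorems.PercNearOneGluingNoHeavyLowerTailOneCutModulus
import HarnessLib

/-!
# `NoHeavyLowerTail` (stmt-CriticalPhenomena-4575) — moment constraints on the pocket size, II:
# mean connection from the half-level tail, and the lower tail versus relay-target event gluing

Support file (depth prover `nh-dp-blobmono`, respawn g3; `--supports stmt-CriticalPhenomena-4575`).
Bookkeeping only: no definitions, no named facts, no sorries.  Part I is `…PocketMoments.lean`.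

Notation as in part I: `μ = prodBernoulli w`, relays `A` (`k = |A|`), observer `o`,
`N = |{a ∈ A : o ↔ a}|`, `E N = Σ_{a∈A} P(o ↔ a)`, `t ≥ P(a ↮ a')` (`a ≠ a'`), `δ₀ = P(o ↮ A)`.

* `PocketMoments.expectedCount_ge` — the converse bookkeeping left unformalised in `…OneCutModulus.lean`:
  `k·P(o ↔ A) − k·P(1 ≤ N ∧ 2N < k) − (2/k)·Σ_a Σ_{b≠a} P(a ↮ b) ≤ E N` (pointwise
  `k·1{N ≥ 1} − k·1{1 ≤ N < k/2} − (2/k)N(k−N) ≤ N`, then the crude split-pair bound of part I);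
  `PocketMoments.expectedCount_ge_of_pairs` — budget form `E N ≥ k(1 − δ₀ − β) − 2(k−1)t` when
  `P(1 ≤ N ∧ 2N < k) ≤ β`.
* `PocketMoments.meanConnection_of_halfLevel` — hence the HALF-LEVEL LOWER TAIL with any modulus
  (`∀ ε ∃ τ`: budgets `≤ τ` ⇒ `P(1 ≤ N ∧ 2N < |A|) ≤ ε`) implies the registered `stub_meanConnection`
  VERBATIM, and `PocketMoments.noHeavyLowerTail_of_halfLevel` composes it with
  `Theorems.noHeavyLowerTail_of_meanConnection` (`…OneCutModulus.lean`) into the crux.  With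
  `Theorems.oneCut_modulus_of_meanConnection` the statements "one-cut with a modulus at level
  `ρ·E N`", "half-level lower tail with a modulus", "mean connection" and the crux are equivalent up to
  moduli (crux ⇒ half level being the Kozma–Nitzan chain).
* `PocketMoments.lowerTail_mul_le_eventGluing` — BELOW `ρ·E N` the weighted first-moment trick gives
  `(E N − θ)·P(1 ≤ N ≤ θ) ≤ E N · max_{a'∈A} P(o ↔ A, o ↮ a')`, i.e.
  `P(1 ≤ N ≤ ρ·E N) ≤ (1−ρ)⁻¹ · max_{a'} P(o ↔ A, o ↮ a')`: a heavy lower tail is exactly a failure of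
  event gluing toward the worst RELAY target (quantitative form of the lead's LEAD-GEN3 §1(c); qualitative
  compositions in the tree: `Theorems.fingerInv_all_of_nearOneGluing`, `Theorems.noHeavyLowerTail_of_fingerInv_all`).
  Together with part I: above `ρ·E N` pairs (Harris) control the law of `N`, below `ρ·E N` relay-target gluing does.
-/

noncomputable section

namespace Summit.CriticalPhenomena.PercolationContinuityZ3.Theorems

namespace PocketMoments

open scoped Classical BigOperators
open MeasureTheory Set
open Literature.Probability.LatticeModels (prodBernoulli prodBernoulli_harris_upper_lower)
open Literature.Probability.Percolation (openConn openGraph openEdgeCluster BondConfig isUpperSet_openConn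
  BHK2006_twoSeparationSets reachable_iff_exists_mem_openEdgeCluster)

variable {n : ℕ}

/-! ### Mean connection from the half-level one-cut bound -/

/-- The pointwise inequality behind the converse bookkeeping: for reals `0 ≤ N ≤ k`, `0 < k`,
`k·1{1 ≤ N} − k·1{1 ≤ N ∧ 2N < k} − (2/k)·N(k−N) ≤ N`. [folklore] -/
theorem pointwise_meanConnection (k N : ℝ) (hk : 0 < k) (hN0 : 0 ≤ N) (hNk : N ≤ k)
    (i₁ i₂ : ℝ) (hi₁ : i₁ = if 1 ≤ N then 1 else 0) (hi₂ : i₂ = if (1 ≤ N ∧ 2 * N < k) then 1 else 0) :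
    k * i₁ - k * i₂ - 2 / k * (N * (k - N)) ≤ N := by
  have hdef : 0 ≤ 2 / k * (N * (k - N)) := by positivity
  by_cases h1 : 1 ≤ N
  · rw [if_pos h1] at hi₁
    by_cases h2 : 2 * N < k
    · rw [if_pos ⟨h1, h2⟩] at hi₂
      rw [hi₁, hi₂]; linarith
    · rw [if_neg (fun h => h2 h.2)] at hi₂
      rw [hi₁, hi₂]
      push Not at h2
      -- `k − N ≤ (2/k) N (k − N)` since `2N ≥ k`
      have hkey : k * (k - N) ≤ 2 * (N * (k - N)) := by nlinarith
      have : k - N ≤ 2 / k * (N * (k - N)) := by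
        rw [div_mul_eq_mul_div, le_div_iff₀ hk]
        linarith
      linarith
  · rw [if_neg h1] at hi₁
    rw [if_neg (fun h => h1 h.1)] at hi₂
    rw [hi₁, hi₂]; nlinarith

/-- **Mean connection from the half-level lower tail** (the converse bookkeeping of
`…OneCutModulus.lean`): with `k = |A| ≥ 1`,
`k·P(o ↔ A) − k·P(1 ≤ N ∧ 2N < k) − (2/k)·Σ_{a} Σ_{b≠a} P(a ↮ b) ≤ E N`. [this work] -/
theorem expectedCount_ge (w : Sym2 (Fin n) → unitInterval) (A : Finset (Fin n)) (o : Fin n)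
    (hA : A.Nonempty) :
    (A.card : ℝ) * (prodBernoulli w).real (⋃ a ∈ A, (openConn o a : Set (BondConfig (Fin n)))) -
        (A.card : ℝ) * (prodBernoulli w).real {ω : BondConfig (Fin n) |
          1 ≤ (A.filter fun a => ω ∈ openConn o a).card ∧ 2 * (A.filter fun a => ω ∈ openConn o a).card < A.card} -
        2 / (A.card : ℝ) *
          ∑ a ∈ A, ∑ b ∈ A.erase a, (prodBernoulli w).real ((openConn a b : Set (BondConfig (Fin n)))ᶜ) ≤
      ∑ a ∈ A, (prodBernoulli w).real (openConn o a : Set (BondConfig (Fin n))) := by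
  set μ := prodBernoulli w with hμ
  set k : ℝ := (A.card : ℝ) with hk
  have hkpos : 0 < k := by
    rw [hk]; exact_mod_cast Finset.card_pos.2 hA
  set U : Set (BondConfig (Fin n)) := ⋃ a ∈ A, (openConn o a : Set (BondConfig (Fin n))) with hU
  set L : Set (BondConfig (Fin n)) := {ω : BondConfig (Fin n) |
      1 ≤ (A.filter fun a => ω ∈ openConn o a).card ∧ 2 * (A.filter fun a => ω ∈ openConn o a).card < A.card}
    with hL
  set Nf : BondConfig (Fin n) → ℝ := fun ω => ((A.filter fun a => ω ∈ openConn o a).card : ℝ) with hNf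
  set D : BondConfig (Fin n) → ℝ := fun ω => Nf ω * (k - Nf ω) with hD
  -- integrability (finite configuration space: everything is a finite sum of indicators)
  have hmeas : ∀ s : Set (BondConfig (Fin n)), MeasurableSet s := fun _ => MeasurableSet.of_discrete
  have hind_int : ∀ s : Set (BondConfig (Fin n)), Integrable (s.indicator fun _ => (1 : ℝ)) μ :=
    fun s => (integrable_const (1 : ℝ)).indicator (hmeas s)
  have hNf_eq : Nf = fun ω => ∑ a ∈ A, (openConn o a : Set (BondConfig (Fin n))).indicator (fun _ => (1 : ℝ)) ω := by
    funext ω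
    simp only [hNf]
    rw [card_filter_eq_sum_ite]
    refine Finset.sum_congr rfl fun a _ => ?_
    by_cases h : ω ∈ (openConn o a : Set (BondConfig (Fin n)))
    · rw [if_pos h, Set.indicator_of_mem h]
    · rw [if_neg h, Set.indicator_of_notMem h]
  have hNf_int : Integrable Nf μ := by
    rw [hNf_eq]; exact integrable_finsetSum A fun a _ => hind_int _
  have hD_int : Integrable D μ := by
    have : D = fun ω => ∑ a ∈ A, ∑ b ∈ A,
        ((openConn o a ∩ (openConn o b)ᶜ : Set (BondConfig (Fin n)))).indicator (fun _ => (1 : ℝ)) ω := by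
      funext ω; exact deficit_eq_sum_indicator A o ω
    rw [this]
    exact integrable_finsetSum A fun a _ => integrable_finsetSum A fun b _ => hind_int _
  -- integrals
  have hNf_integral : ∫ ω, Nf ω ∂μ = ∑ a ∈ A, μ.real (openConn o a : Set (BondConfig (Fin n))) := by
    rw [hNf_eq, integral_finsetSum A fun a _ => hind_int _]
    refine Finset.sum_congr rfl fun a _ => ?_
    rw [integral_indicator_const (1 : ℝ) (hmeas _), smul_eq_mul, mul_one]
  have hU_integral : ∫ ω, U.indicator (fun _ => (1 : ℝ)) ω ∂μ = μ.real U := by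
    rw [integral_indicator_const (1 : ℝ) (hmeas _), smul_eq_mul, mul_one]
  have hL_integral : ∫ ω, L.indicator (fun _ => (1 : ℝ)) ω ∂μ = μ.real L := by
    rw [integral_indicator_const (1 : ℝ) (hmeas _), smul_eq_mul, mul_one]
  have hD_le := integral_deficit_le_pairSum w A o
  -- pointwise inequality
  have hpt : ∀ ω, k * U.indicator (fun _ => (1 : ℝ)) ω - k * L.indicator (fun _ => (1 : ℝ)) ω
      - 2 / k * D ω ≤ Nf ω := by
    intro ω
    have hN0 : 0 ≤ Nf ω := Nat.cast_nonneg _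
    have hNk : Nf ω ≤ k := by
      simp only [hNf, hk]; exact_mod_cast Finset.card_filter_le _ _
    -- indicator of `U` is `1{1 ≤ N}`
    have hU_ind : U.indicator (fun _ => (1 : ℝ)) ω = if 1 ≤ Nf ω then 1 else 0 := by
      by_cases hω : ω ∈ U
      · rw [Set.indicator_of_mem hω]
        obtain ⟨a, ha, hωa⟩ := Set.mem_iUnion₂.1 hω
        have : 1 ≤ (A.filter fun a => ω ∈ openConn o a).card :=
          Finset.card_pos.2 ⟨a, Finset.mem_filter.2 ⟨ha, hωa⟩⟩
        have h1 : (1 : ℝ) ≤ Nf ω := by simp only [hNf]; exact_mod_cast this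
        rw [if_pos h1]
      · rw [Set.indicator_of_notMem hω]
        have : (A.filter fun a => ω ∈ openConn o a).card = 0 := by
          rw [Finset.card_eq_zero, Finset.filter_eq_empty_iff]
          intro a ha hωa
          exact hω (Set.mem_iUnion₂.2 ⟨a, ha, hωa⟩)
        have h1 : ¬ (1 : ℝ) ≤ Nf ω := by simp only [hNf, this]; norm_num
        rw [if_neg h1]
    have hL_ind : L.indicator (fun _ => (1 : ℝ)) ω = if (1 ≤ Nf ω ∧ 2 * Nf ω < k) then 1 else 0 := by
      by_cases hω : ω ∈ L
      · rw [Set.indicator_of_mem hω]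
        obtain ⟨h1, h2⟩ := hω
        have h1' : (1 : ℝ) ≤ Nf ω := by simp only [hNf]; exact_mod_cast h1
        have h2' : 2 * Nf ω < k := by simp only [hNf, hk]; exact_mod_cast h2
        rw [if_pos ⟨h1', h2'⟩]
      · rw [Set.indicator_of_notMem hω]
        have : ¬ (1 ≤ Nf ω ∧ 2 * Nf ω < k) := by
          rintro ⟨h1', h2'⟩
          apply hω
          refine ⟨?_, ?_⟩
          · simp only [hNf] at h1'; exact_mod_cast h1'
          · simp only [hNf, hk] at h2'; exact_mod_cast h2'
        rw [if_neg this]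
    exact pointwise_meanConnection k (Nf ω) hkpos hN0 hNk _ _ hU_ind hL_ind
  -- integrate
  have hf1 : Integrable (fun ω => k * U.indicator (fun _ => (1 : ℝ)) ω) μ := (hind_int U).const_mul k
  have hf2 : Integrable (fun ω => k * L.indicator (fun _ => (1 : ℝ)) ω) μ := (hind_int L).const_mul k
  have hf12 : Integrable (fun ω => k * U.indicator (fun _ => (1 : ℝ)) ω -
      k * L.indicator (fun _ => (1 : ℝ)) ω) μ := hf1.sub hf2
  have hf3 : Integrable (fun ω => 2 / k * D ω) μ := hD_int.const_mul (2 / k)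
  have hlhs_int : Integrable (fun ω => k * U.indicator (fun _ => (1 : ℝ)) ω -
      k * L.indicator (fun _ => (1 : ℝ)) ω - 2 / k * D ω) μ := hf12.sub hf3
  have hmono := integral_mono hlhs_int hNf_int hpt
  have hI : ∫ ω, (k * U.indicator (fun _ => (1 : ℝ)) ω - k * L.indicator (fun _ => (1 : ℝ)) ω
      - 2 / k * D ω) ∂μ = k * μ.real U - k * μ.real L - 2 / k * ∫ ω, D ω ∂μ := by
    rw [integral_sub hf12 hf3, integral_sub hf1 hf2, integral_const_mul, integral_const_mul,
      integral_const_mul, hU_integral, hL_integral]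
  rw [hI, hNf_integral] at hmono
  have h2k : 0 ≤ 2 / k := by positivity
  have hDbound : 2 / k * ∫ ω, D ω ∂μ ≤
      2 / k * ∑ a ∈ A, ∑ b ∈ A.erase a, μ.real ((openConn a b : Set (BondConfig (Fin n)))ᶜ) :=
    mul_le_mul_of_nonneg_left hD_le h2k
  linarith

/-- **Mean connection from the half-level lower tail, budget form**: if `P(o ↮ A) ≤ δ₀`,
`P(a ↮ b) ≤ t` for `a ≠ b` in `A`, and `P(1 ≤ N ∧ 2N < |A|) ≤ β`, then
`E N ≥ |A|·(1 − δ₀ − β) − 2(|A| − 1)·t`.  With `Theorems.oneCut_modulus_of_meanConnection` this closes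
the loop "one-cut bound at level `1/2` (any modulus) ⇔ mean connection" up to moduli. [this work] -/
theorem expectedCount_ge_of_pairs (w : Sym2 (Fin n) → unitInterval) (A : Finset (Fin n)) (o : Fin n)
    (hA : A.Nonempty) (δ₀ t β : ℝ)
    (hδ₀ : (prodBernoulli w).real (⋃ a ∈ A, (openConn o a : Set (BondConfig (Fin n))))ᶜ ≤ δ₀)
    (ht : ∀ a ∈ A, ∀ b ∈ A, a ≠ b → (prodBernoulli w).real ((openConn a b : Set (BondConfig (Fin n)))ᶜ) ≤ t)
    (hβ : (prodBernoulli w).real {ω : BondConfig (Fin n) |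
          1 ≤ (A.filter fun a => ω ∈ openConn o a).card ∧ 2 * (A.filter fun a => ω ∈ openConn o a).card < A.card} ≤ β) :
    (A.card : ℝ) * (1 - δ₀ - β) - 2 * ((A.card : ℝ) - 1) * t ≤
      ∑ a ∈ A, (prodBernoulli w).real (openConn o a : Set (BondConfig (Fin n))) := by
  set μ := prodBernoulli w with hμ
  set k : ℝ := (A.card : ℝ) with hk
  have hkpos : 0 < k := by rw [hk]; exact_mod_cast Finset.card_pos.2 hA
  have hk1 : 1 ≤ k := by rw [hk]; exact_mod_cast Finset.card_pos.2 hA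
  have hmain := expectedCount_ge w A o hA
  have hmeas : ∀ s : Set (BondConfig (Fin n)), MeasurableSet s := fun _ => MeasurableSet.of_discrete
  have hUc : μ.real (⋃ a ∈ A, (openConn o a : Set (BondConfig (Fin n)))) = 1 -
      μ.real (⋃ a ∈ A, (openConn o a : Set (BondConfig (Fin n))))ᶜ := by
    rw [probReal_compl_eq_one_sub (hmeas _)]; ring
  have hpairs : ∑ a ∈ A, ∑ b ∈ A.erase a, μ.real ((openConn a b : Set (BondConfig (Fin n)))ᶜ) ≤
      k * ((k - 1) * t) := by
    calc ∑ a ∈ A, ∑ b ∈ A.erase a, μ.real ((openConn a b : Set (BondConfig (Fin n)))ᶜ)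
        ≤ ∑ a ∈ A, ((k - 1) * t) := by
          refine Finset.sum_le_sum fun a ha => ?_
          calc ∑ b ∈ A.erase a, μ.real ((openConn a b : Set (BondConfig (Fin n)))ᶜ)
              ≤ ∑ _b ∈ A.erase a, t :=
                Finset.sum_le_sum fun b hb => ht a ha b (Finset.mem_of_mem_erase hb)
                  (Finset.ne_of_mem_erase hb).symm
            _ = (k - 1) * t := by
                rw [Finset.sum_const, nsmul_eq_mul, Finset.card_erase_of_mem ha, Nat.cast_sub
                  (Finset.card_pos.2 ⟨a, ha⟩), Nat.cast_one]
      _ = k * ((k - 1) * t) := by rw [Finset.sum_const, nsmul_eq_mul]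
  have h2k : 0 ≤ 2 / k := by positivity
  have hdiv : 2 / k * (k * ((k - 1) * t)) = 2 * (k - 1) * t := by
    field_simp
  have hstep : 2 / k * ∑ a ∈ A, ∑ b ∈ A.erase a, μ.real ((openConn a b : Set (BondConfig (Fin n)))ᶜ) ≤
      2 * (k - 1) * t := by
    rw [← hdiv]; exact mul_le_mul_of_nonneg_left hpairs h2k
  rw [hUc] at hmain
  have hk0 : 0 ≤ k := hkpos.le
  nlinarith [mul_le_mul_of_nonneg_left hδ₀ hk0, mul_le_mul_of_nonneg_left hβ hk0]

/-! ### The half-level lower tail (any modulus) ⇒ mean connection ⇒ the crux -/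

/-- **Half-level lower tail with a modulus ⇒ mean connection** (the registered `stub_meanConnection` of crux
stmt-CriticalPhenomena-4575, verbatim): if for every `ε > 0` there is `τ > 0` such that pairwise relay
disconnections `≤ τ` and `P(o ↮ A) ≤ τ` force `P(1 ≤ N ∧ 2N < |A|) ≤ ε`, then for every `ε > 0` there is
`τ > 0` such that the same budgets force `(1 − ε)|A| ≤ E N` (take the data of `ε/4` and `τ ≤ ε/4`:
`E N ≥ |A|(1 − ε/4 − ε/4) − 2(|A|−1)·ε/4 ≥ (1 − ε)|A|`). [this work] -/
theorem meanConnection_of_halfLevel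
    (hhalf : ∀ ε : ℝ, 0 < ε → ∃ τ : ℝ, 0 < τ ∧ ∀ (n : ℕ) (w : Sym2 (Fin n) → unitInterval) (A : Finset (Fin n)) (o : Fin n), (∀ a ∈ A, ∀ a' ∈ A, a ≠ a' → (Literature.Probability.LatticeModels.prodBernoulli w).real (Literature.Probability.Percolation.openConn a a')ᶜ ≤ τ) → (Literature.Probability.LatticeModels.prodBernoulli w).real (⋃ a ∈ A, (Literature.Probability.Percolation.openConn o a : Set (Literature.Probability.Percolation.BondConfig (Fin n))))ᶜ ≤ τ → (Literature.Probability.LatticeModels.prodBernoulli w).real {ω : Literature.Probability.Percolation.BondConfig (Fin n) | 1 ≤ (A.filter fun a => ω ∈ Literature.Probability.Percolation.openConn o a).card ∧ 2 * (A.filter fun a => ω ∈ Literature.Probability.Percolation.openConn o a).card < A.card} ≤ ε) :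
    ∀ ε : ℝ, 0 < ε → ∃ τ : ℝ, 0 < τ ∧ ∀ (n : ℕ) (w : Sym2 (Fin n) → unitInterval) (A : Finset (Fin n)) (o : Fin n), (∀ a ∈ A, ∀ a' ∈ A, a ≠ a' → (Literature.Probability.LatticeModels.prodBernoulli w).real (Literature.Probability.Percolation.openConn a a')ᶜ ≤ τ) → (Literature.Probability.LatticeModels.prodBernoulli w).real (⋃ a ∈ A, (Literature.Probability.Percolation.openConn o a : Set (Literature.Probability.Percolation.BondConfig (Fin n))))ᶜ ≤ τ → (1 - ε) * (A.card : ℝ) ≤ ∑ a ∈ A, (Literature.Probability.LatticeModels.prodBernoulli w).real (Literature.Probability.Percolation.openConn o a) := by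
  intro ε hε
  obtain ⟨τ₀, hτ₀, h⟩ := hhalf (ε / 4) (by positivity)
  refine ⟨min τ₀ (ε / 4), lt_min hτ₀ (by positivity), fun n w A o hpair hobs => ?_⟩
  by_cases hA : A = ∅
  · simp [hA]
  have hAne : A.Nonempty := Finset.nonempty_iff_ne_empty.2 hA
  have hpair' : ∀ a ∈ A, ∀ a' ∈ A, a ≠ a' →
      (prodBernoulli w).real ((openConn a a' : Set (BondConfig (Fin n)))ᶜ) ≤ τ₀ :=
    fun a ha a' ha' hne => (hpair a ha a' ha' hne).trans (min_le_left _ _)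
  have hpair'' : ∀ a ∈ A, ∀ a' ∈ A, a ≠ a' →
      (prodBernoulli w).real ((openConn a a' : Set (BondConfig (Fin n)))ᶜ) ≤ ε / 4 :=
    fun a ha a' ha' hne => (hpair a ha a' ha' hne).trans (min_le_right _ _)
  have hβ := h n w A o hpair' (hobs.trans (min_le_left _ _))
  have hmain := expectedCount_ge_of_pairs w A o hAne (ε / 4) (ε / 4) (ε / 4)
    (hobs.trans (min_le_right _ _)) hpair'' hβ
  have hk1 : (1 : ℝ) ≤ A.card := by exact_mod_cast Finset.card_pos.2 hAne
  nlinarith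


/-- **Half-level lower tail with a modulus ⇒ `NoHeavyLowerTail`**: through mean connection
(`meanConnection_of_halfLevel`) and `Theorems.noHeavyLowerTail_of_meanConnection`.  So the crux is
equivalent (up to moduli; the converse is the Kozma–Nitzan chain crux ⇒ near-one gluing ⇒ mean connection)
to: `P(1 ≤ N < |A|/2) → 0` as `max_{a≠a'} P(a ↮ a') + P(o ↮ A) → 0`, uniformly in the graph and in `|A|`.
[this work] -/
theorem noHeavyLowerTail_of_halfLevel
    (hhalf : ∀ ε : ℝ, 0 < ε → ∃ τ : ℝ, 0 < τ ∧ ∀ (n : ℕ) (w : Sym2 (Fin n) → unitInterval) (A : Finset (Fin n)) (o : Fin n), (∀ a ∈ A, ∀ a' ∈ A, a ≠ a' → (Literature.Probability.LatticeModels.prodBernoulli w).real (Literature.Probability.Percolation.openConn a a')ᶜ ≤ τ) → (Literature.Probability.LatticeModels.prodBernoulli w).real (⋃ a ∈ A, (Literature.Probability.Percolation.openConn o a : Set (Literature.Probability.Percolation.BondConfig (Fin n))))ᶜ ≤ τ → (Literature.Probability.LatticeModels.prodBernoulli w).real {ω : Literature.Probability.Percolation.BondConfig (Fin n) | 1 ≤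 (A.filter fun a => ω ∈ Literature.Probability.Percolation.openConn o a).card ∧ 2 * (A.filter fun a => ω ∈ Literature.Probability.Percolation.openConn o a).card < A.card} ≤ ε) :
    Summit.CriticalPhenomena.PercolationContinuityZ3.Theses.PercNearOneGluing.NoHeavyLowerTail :=
  noHeavyLowerTail_of_meanConnection (meanConnection_of_halfLevel hhalf)

/-! ### Below `ρ·E N`: the lower tail is controlled by event gluing with the worst RELAY target -/

/-- **Lower tail versus relay-target event gluing** (weighted first-moment trick): for every real `θ`,
`(E N − θ) · P(1 ≤ N ∧ N ≤ θ) ≤ E N · M` whenever `P(o ↔ A, o ↮ a') ≤ M` for every `a' ∈ A`.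
On the event, `Σ_{a'} P(o ↔ a')·1{o ↮ a'} = E N − Σ_{a ∈ π(o)} P(o ↔ a) ≥ E N − N ≥ E N − θ`; integrate and
use `{1 ≤ N} = {o ↔ A}`.  With `θ = ρ·E N`: `P(1 ≤ N ≤ ρ·E N) ≤ (1 − ρ)⁻¹ · max_{a' ∈ A} P(o ↔ A, o ↮ a')`,
the quantitative form of "near-one gluing toward relay targets ⇒ no heavy lower tail" (lead memo
LEAD-GEN3 §1(c); qualitative compositions `Theorems.fingerInv_all_of_nearOneGluing`,
`Theorems.noHeavyLowerTail_of_fingerInv_all`). [this work] -/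
theorem lowerTail_mul_le_eventGluing (w : Sym2 (Fin n) → unitInterval) (A : Finset (Fin n)) (o : Fin n)
    (θ M : ℝ)
    (hM : ∀ a' ∈ A, (prodBernoulli w).real ((⋃ a ∈ A, (openConn o a : Set (BondConfig (Fin n)))) ∩
      (openConn o a' : Set (BondConfig (Fin n)))ᶜ) ≤ M) :
    ((∑ a ∈ A, (prodBernoulli w).real (openConn o a : Set (BondConfig (Fin n)))) - θ) *
        (prodBernoulli w).real {ω : BondConfig (Fin n) |
          1 ≤ (A.filter fun a => ω ∈ openConn o a).card ∧ ((A.filter fun a => ω ∈ openConn o a).card : ℝ) ≤ θ} ≤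
      (∑ a ∈ A, (prodBernoulli w).real (openConn o a : Set (BondConfig (Fin n)))) * M := by
  set μ := prodBernoulli w with hμ
  set EN : ℝ := ∑ a ∈ A, μ.real (openConn o a : Set (BondConfig (Fin n))) with hEN
  set U : Set (BondConfig (Fin n)) := ⋃ a ∈ A, (openConn o a : Set (BondConfig (Fin n))) with hU
  set E : Set (BondConfig (Fin n)) := {ω : BondConfig (Fin n) |
      1 ≤ (A.filter fun a => ω ∈ openConn o a).card ∧ ((A.filter fun a => ω ∈ openConn o a).card : ℝ) ≤ θ}
    with hE
  have hmeas : ∀ s : Set (BondConfig (Fin n)), MeasurableSet s := fun _ => MeasurableSet.of_discrete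
  -- the weights `P(o ↔ a')` are nonnegative
  have hq0 : ∀ a ∈ A, 0 ≤ μ.real (openConn o a : Set (BondConfig (Fin n))) := fun _ _ => measureReal_nonneg
  -- `E ⊆ U`
  have hEU : E ⊆ U := by
    rintro ω ⟨h1, _⟩
    obtain ⟨a, ha⟩ := Finset.card_pos.1 h1
    exact Set.mem_iUnion₂.2 ⟨a, (Finset.mem_filter.1 ha).1, (Finset.mem_filter.1 ha).2⟩
  -- the functions
  set F : BondConfig (Fin n) → ℝ := fun ω => ∑ a' ∈ A, μ.real (openConn o a' : Set (BondConfig (Fin n))) *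
      (E ∩ (openConn o a' : Set (BondConfig (Fin n)))ᶜ).indicator (fun _ => (1 : ℝ)) ω with hF
  have hind_int : ∀ s : Set (BondConfig (Fin n)), Integrable (s.indicator fun _ => (1 : ℝ)) μ :=
    fun s => (integrable_const (1 : ℝ)).indicator (hmeas s)
  have hF_int : Integrable F μ :=
    integrable_finsetSum A fun a' _ => (hind_int _).const_mul _
  have hF_integral : ∫ ω, F ω ∂μ = ∑ a' ∈ A, μ.real (openConn o a' : Set (BondConfig (Fin n))) *
      μ.real (E ∩ (openConn o a' : Set (BondConfig (Fin n)))ᶜ) := by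
    rw [integral_finsetSum A fun a' _ => (hind_int _).const_mul _]
    refine Finset.sum_congr rfl fun a' _ => ?_
    rw [integral_const_mul, integral_indicator_const (1 : ℝ) (hmeas _), smul_eq_mul, mul_one]
  have hE_integral : ∫ ω, E.indicator (fun _ => (EN - θ)) ω ∂μ = (EN - θ) * μ.real E := by
    rw [integral_indicator_const _ (hmeas _), smul_eq_mul, mul_comm]
  -- pointwise: `(EN − θ)·1_E ≤ F`
  have hpt : ∀ ω, E.indicator (fun _ => (EN - θ)) ω ≤ F ω := by
    intro ω
    have hF0 : 0 ≤ F ω :=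
      Finset.sum_nonneg fun a' ha' => mul_nonneg (hq0 a' ha') (Set.indicator_nonneg (fun _ _ => zero_le_one) _)
    by_cases hω : ω ∈ E
    · rw [Set.indicator_of_mem hω]
      -- `F ω = EN − Σ_{a' : o ↔ a'} P(o ↔ a') ≥ EN − N ≥ EN − θ`
      have hterm : ∀ a' ∈ A, μ.real (openConn o a' : Set (BondConfig (Fin n))) *
          (E ∩ (openConn o a' : Set (BondConfig (Fin n)))ᶜ).indicator (fun _ => (1 : ℝ)) ω =
          μ.real (openConn o a' : Set (BondConfig (Fin n))) -
            (if ω ∈ (openConn o a' : Set (BondConfig (Fin n))) then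
              μ.real (openConn o a' : Set (BondConfig (Fin n))) else 0) := by
        intro a' _
        by_cases h : ω ∈ (openConn o a' : Set (BondConfig (Fin n)))
        · rw [if_pos h, Set.indicator_of_notMem (fun h' => h'.2 h)]; ring
        · rw [if_neg h, Set.indicator_of_mem (show ω ∈ E ∩ (openConn o a')ᶜ from ⟨hω, h⟩)]; ring
      have hFω : F ω = EN - ∑ a' ∈ A, (if ω ∈ (openConn o a' : Set (BondConfig (Fin n))) then
          μ.real (openConn o a' : Set (BondConfig (Fin n))) else 0) := by
        simp only [hF]
        rw [Finset.sum_congr rfl hterm, Finset.sum_sub_distrib]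
      have hsum_le : ∑ a' ∈ A, (if ω ∈ (openConn o a' : Set (BondConfig (Fin n))) then
          μ.real (openConn o a' : Set (BondConfig (Fin n))) else 0) ≤
          ((A.filter fun a => ω ∈ openConn o a).card : ℝ) := by
        rw [card_filter_eq_sum_ite]
        refine Finset.sum_le_sum fun a' _ => ?_
        by_cases h : ω ∈ (openConn o a' : Set (BondConfig (Fin n)))
        · rw [if_pos h, if_pos h]; exact measureReal_le_one
        · rw [if_neg h, if_neg h]
      rw [hFω]
      linarith [hω.2]
    · rw [Set.indicator_of_notMem hω]; exact hF0
  have hmono := integral_mono ((integrable_const (EN - θ)).indicator (hmeas E)) hF_int hpt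
  rw [hE_integral, hF_integral] at hmono
  -- bound each `μ(E ∩ {o ↮ a'}) ≤ μ(U ∩ {o ↮ a'}) ≤ M`
  have hlast : ∑ a' ∈ A, μ.real (openConn o a' : Set (BondConfig (Fin n))) *
      μ.real (E ∩ (openConn o a' : Set (BondConfig (Fin n)))ᶜ) ≤ EN * M := by
    rw [hEN, Finset.sum_mul]
    refine Finset.sum_le_sum fun a' ha' => mul_le_mul_of_nonneg_left ?_ (hq0 a' ha')
    exact (measureReal_mono (Set.inter_subset_inter_left _ hEU)).trans (hM a' ha')
  exact hmono.trans hlast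

end PocketMoments

end Summit.CriticalPhenomena.PercolationContinuityZ3.Theorems

end
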